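import Summits.Schanuel.Schanuel.Theorems.RootDecomp1KHyper32

/-!
# RootDecomp1KHyper — lens 6, generation 15 ADDENDUM «EXP-LATTICE-ANCHORED CELL» (ExpAnchorT.lean v2 88910796…, 2341 l) — continuation (RootDecomp1KHyper33): the member ξ_E = e^{−√2}, z_E (`hyperLatApprox_yE`, `hyperLinLiouville_zE`, `hasExpIntAnchor_zE`, `ternarySmallForms_zE`, `linearIndependent_zE`, `sb_three_zE`); ℓ2 block (`not_isAlgebraic_affine`, `algebraicIndependent_latTriple_one_cexp`, `eq_intCast_of_isAlgebraic_mem_span_latTriple` / `_zE`)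

(lens-6 g15-addendum `ExpAnchorT.lean` v2, sha256 88910796…cc8b, farm rc 0 · 0 sorry · axioms std; port by census-1 gen 14 in eight parts RootDecomp1KHyper28–35, cuts of CENSUS-REQUEST STATUS L1561 re-balanced for the 400-line cap,
critic PORT GO L1568 (e) / ACK L1571; import `RootDecomp1KHyper26`, the source's verbatim g15 plane-lemma copy dropped (exported by Hyper26 in `…HyperCell`), sub-namespace `…HyperCell.LatCell` kept; statements and proofs verbatim
(55 docstrings added, seven generic one-liners privatised with per-part private copies); `hLW : LWMeasure` (tree-proved named fact) stays a binder; `--supports stmt-Schanuel-33363` (residual of record n = 3 := UnanchoredResidual₃′). Nothing here proves Schanuel; rung 0.)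
-/

noncomputable section

open Complex IntermediateField Polynomial

namespace Summit.Schanuel.Schanuel.Theorems.RootDecomp1KHyper

namespace HyperCell

namespace LatCell

variable {n : ℕ}
open Summit.Schanuel.Schanuel.Theorems.RootDecomp1KGeneric (HasHLPairInSpan Rank3SpanResidual
  mem_adjoin_of_mem_span cexp_mem_adjoin_of_mem_span)

/-! ### The member `ξ = e^{−√2}` -/

/-- `ξ_E = e^{−√2}`. -/
def ξE : ℝ := Real.exp (-Real.sqrt 2)

/-- `ξ_E = e^{−√2}` is positive. -/
theorem ξE_pos : 0 < ξE := Real.exp_pos _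

/-- `ξ_E = e^{−√2} ≤ 3/2`. -/
theorem ξE_le : ξE ≤ 3 / 2 :=
  (Real.exp_le_one_iff.mpr (neg_nonpos.mpr (Real.sqrt_nonneg 2))).trans (by norm_num)

/-- `α_E = −√2 ∈ ℚ̄ ∖ ℚ`, `e^{α_E} = ξ_E`. -/
def αE : ℂ := -((Real.sqrt 2 : ℝ) : ℂ)

/-- `e^{α_E} = ξ_E` for `α_E = −√2`. -/
theorem cexp_αE : cexp αE = (ξE : ℂ) := by
  rw [αE, ξE, Complex.ofReal_exp]; push_cast; ring_nf

/-- `α_E = −√2` is algebraic. -/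
theorem isAlgebraic_αE : IsAlgebraic ℚ αE := by
  have h2 : IsAlgebraic ℚ ((Real.sqrt 2 : ℝ) : ℂ) := by
    refine ⟨Polynomial.X ^ 2 - Polynomial.C 2, ?_, ?_⟩
    · intro h
      have := congr_arg (Polynomial.eval 0) h
      simp at this
    · have hs : ((Real.sqrt 2 : ℝ) : ℂ) ^ 2 = 2 := by
        rw [← Complex.ofReal_pow, Real.sq_sqrt (by norm_num : (0 : ℝ) ≤ 2)]; push_cast; rfl
      simp [hs]
  exact h2.neg

/-- `α_E = −√2` is not rational. -/
theorem αE_ne_ratCast (r : ℚ) : αE ≠ (r : ℂ) := by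
  intro h
  have h1 : ((-Real.sqrt 2 : ℝ) : ℂ) = ((r : ℝ) : ℂ) := by
    rw [Complex.ofReal_ratCast]; push_cast; simpa [αE] using h
  have h2 : -Real.sqrt 2 = (r : ℝ) := by exact_mod_cast h1
  exact irrational_sqrt_two.neg.ne_rat r h2

/-- The member `z_E = (1, e^{−√2}, y_E)`. -/
def zE : Fin 3 → ℂ := latTriple 1 (ξE : ℂ) (yx ξE : ℂ)

/-- `z_E = (1, e^{α_E}, y_E)` as a `latTriple`. -/
theorem zE_eq : zE = latTriple 1 (cexp αE) (yx ξE : ℂ) := by rw [cexp_αE]; rfl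

/-- `y_E` is hyper-approximable from `ℤ + ℤ e^{−√2}` (unconditional, explicit). -/
theorem hyperLatApprox_yE : HyperLatApprox 1 (ξE : ℂ) (yx ξE : ℂ) := hyperLatApprox_yx ξE_pos ξE_le

/-- `z_E` is `HyperLinLiouville` (unconditional). -/
theorem hyperLinLiouville_zE : HyperLinLiouville zE := hyperLinLiouville_latTriple hyperLatApprox_yE

/-- `z_E` carries the one-exponential anchor (unconditional). -/
theorem hasExpIntAnchor_zE : HasExpIntAnchor zE := by
  rw [zE_eq]; exact hasExpIntAnchor_latTriple isAlgebraic_αE αE_ne_ratCast _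

/-- The small forms of `z_E` are genuinely ternary at every level (unconditional). -/
theorem ternarySmallForms_zE (m : ℕ) :
    ∃ h : Fin 3 → ℤ, (∀ i, h i ≠ 0) ∧
      ‖∑ i, (h i : ℂ) * zE i‖ < Real.exp (-((1 + ∑ i, |(h i : ℝ)|) ^ m)) :=
  ternarySmallForms_yx ξE_pos ξE_le m

/-- `z_E` is ℚ-free (mod the LW measure, which supplies Liouville's inequality for `ℤ + ℤe^{−√2}`). -/
theorem linearIndependent_zE (hLW : LWMeasure) : LinearIndependent ℚ zE := by
  rw [zE_eq]
  exact linearIndependent_latTriple (latLB_one_cexp hLW isAlgebraic_αE αE_ne_ratCast)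
    (cexp_αE ▸ hyperLatApprox_yE)

/-- **THE EXPLICIT MEMBER (mod the LW measure): `trdeg ℚ(e^{−√2}, y_E, e, e^{e^{−√2}}, e^{y_E}) ≥ 3`**,
Schanuel's bound for the ℚ-free `HyperLinLiouville` triple `z_E = (1, e^{−√2}, y_E)` — a point of
the residual `Rank3SpanResidual`'s domain OUTSIDE the g15 (real-quadratic-anchored) cell's obvious
reach: its anchor line is spanned by the transcendental `e^{−√2}`. -/
theorem sb_three_zE (hLW : LWMeasure) : SB 3 zE :=
  sb_three_of_expIntAnchor hLW (linearIndependent_zE hLW) hyperLinLiouville_zE hasExpIntAnchor_zE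

/-! ### `z_E` lies in the critic's class ℓ2: EXACTLY ONE algebraic line in `span_ℤ(z_E)` (mod LW)

`(y_E, e, e^{−√2})` is algebraically independent (the engine), so an algebraic element
`a + b e^{−√2} + c y_E` of `span_ℤ(z_E)` has `b = c = 0`: the algebraic numbers in the span are
exactly `ℤ · 1`. -/

/-- Affine combinations `a + b θ₁ + c y`, `(b, c) ≠ 0`, of an algebraically independent `(y, θ)` are
transcendental. -/
theorem not_isAlgebraic_affine {θ : Fin 2 → ℂ} {y : ℂ}
    (hF : AlgebraicIndependent ℚ (fun o : Option (Fin 2) => o.elim y θ)) {x : ℂ} (hx : θ 1 = x)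
    {a b c : ℤ} (hbc : b ≠ 0 ∨ c ≠ 0) : ¬ IsAlgebraic ℚ ((a : ℂ) + (b : ℂ) * x + (c : ℂ) * y) := by
  rintro ⟨μ, hμ0, hμ⟩
  subst hx
  set F : Option (Fin 2) → ℂ := fun o => o.elim y θ with hFdef
  set Q : MvPolynomial (Option (Fin 2)) ℚ := MvPolynomial.C (a : ℚ) +
    MvPolynomial.C (b : ℚ) * MvPolynomial.X (some 1) + MvPolynomial.C (c : ℚ) * MvPolynomial.X none
    with hQ
  have hQF : MvPolynomial.aeval F Q = (a : ℂ) + (b : ℂ) * θ 1 + (c : ℂ) * y := by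
    simp [hQ, hFdef]
  have hP : MvPolynomial.aeval F (Polynomial.aeval Q μ) = 0 := by
    rw [← Polynomial.aeval_algHom_apply, hQF, hμ]
  have hP0 : Polynomial.aeval Q μ = 0 := (algebraicIndependent_iff.mp hF) _ hP
  -- specialise `X_none ↦ c T`, `X_{some 1} ↦ b T`, `X_{some 0} ↦ 0`: `Q ↦ a + (b² + c²) T`
  set s : ℚ := (b : ℚ) ^ 2 + (c : ℚ) ^ 2 with hs
  have hs0 : s ≠ 0 := by
    have : (0 : ℚ) < s := by
      rcases hbc with h | h
      · have h' : (b : ℚ) ≠ 0 := by exact_mod_cast h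
        rw [hs]; positivity
      · have h' : (c : ℚ) ≠ 0 := by exact_mod_cast h
        rw [hs]; positivity
    exact this.ne'
  set g : Option (Fin 2) → ℚ[X] := fun o => o.elim (Polynomial.C (c : ℚ) * Polynomial.X)
    (fun _ => Polynomial.C (b : ℚ) * Polynomial.X) with hg
  have hgQ : MvPolynomial.aeval g Q = Polynomial.C s * Polynomial.X + Polynomial.C (a : ℚ) := by
    simp only [hQ, hg, map_add, map_mul, MvPolynomial.aeval_C, MvPolynomial.aeval_X,
      Polynomial.algebraMap_eq, Option.elim, hs, map_pow]
    ring
  have h2 := congr_arg (MvPolynomial.aeval g) hP0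
  rw [map_zero, ← Polynomial.aeval_algHom_apply, hgQ, ← Polynomial.comp_eq_aeval] at h2
  have hdeg : (Polynomial.C s * Polynomial.X + Polynomial.C (a : ℚ)).natDegree = 1 := by
    rw [Polynomial.natDegree_add_C, Polynomial.natDegree_C_mul_X _ hs0]
  have h3 := Polynomial.natDegree_comp (p := μ) (q := Polynomial.C s * Polynomial.X + Polynomial.C (a : ℚ))
  rw [h2, Polynomial.natDegree_zero, hdeg, mul_one] at h3
  have h4 := Polynomial.eq_C_of_natDegree_eq_zero h3.symm
  rw [h4, Polynomial.C_comp, map_eq_zero] at h2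
  apply hμ0
  rw [h4, h2, map_zero]

/-- **`(y, e, e^{α})` is algebraically independent over ℚ (mod the LW measure)** for `α ∈ ℚ̄ ∖ ℚ` and
`y` hyper-approximable from `ℤ + ℤe^{α}` — the engine at the measured pair `(e, e^{α})`. -/
theorem algebraicIndependent_latTriple_one_cexp (hLW : LWMeasure) {α : ℂ} (hα : IsAlgebraic ℚ α)
    (hirr : ∀ r : ℚ, α ≠ (r : ℂ)) {y : ℂ} (hy : HyperLatApprox 1 (cexp α) y) :
    AlgebraicIndependent ℚ (fun o : Option (Fin 2) =>
      o.elim y (fun i => cexp ((![(1 : ℂ), α] : Fin 2 → ℂ) i))) := by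
  set u : Fin 2 → ℂ := ![(1 : ℂ), α] with hu
  have hua : ∀ i, IsAlgebraic ℚ (u i) := by
    intro i
    match i with
    | 0 => simpa [hu] using isAlgebraic_algebraMap (R := ℚ) (A := ℂ) (1 : ℚ)
    | 1 => simpa [hu] using hα
  have hli : LinearIndependent ℚ u := by
    have h := linearIndependent_int_irrat hirr (one_ne_zero (α := ℤ))
    simpa [hu] using h
  have hθ := mvPolyMeasure_exp_of_LW hLW hua hli
  have e₁ : MvPolynomial.aeval (fun i => cexp (u i)) (MvPolynomial.C 1 : MvPolynomial (Fin 2) ℤ) = 1 := by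
    simp
  have e₂ : MvPolynomial.aeval (fun i => cexp (u i))
      (MvPolynomial.C 1 * MvPolynomial.X 1 : MvPolynomial (Fin 2) ℤ) = cexp α := by
    simp [hu]
  have hy' : HyperLatApprox (MvPolynomial.aeval (fun i => cexp (u i)) (MvPolynomial.C 1 : MvPolynomial (Fin 2) ℤ))
      (MvPolynomial.aeval (fun i => cexp (u i)) (MvPolynomial.C 1 * MvPolynomial.X 1 : MvPolynomial (Fin 2) ℤ))
      y := by
    rw [e₁, e₂]; exact hy
  exact algebraicIndependent_option_of_mvWeakMeasure_hyperLat (MvPolyMeasure.mvWeakMeasure hθ) _ _ hy'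

/-- **ℓ2 (mod the LW measure): the algebraic numbers in `span_ℤ(1, e^{α}, y)` are exactly the
integers** (`α ∈ ℚ̄ ∖ ℚ`, `y` hyper-approximable from `ℤ + ℤe^{α}`): EXACTLY ONE algebraic line. -/
theorem eq_intCast_of_isAlgebraic_mem_span_latTriple (hLW : LWMeasure) {α : ℂ}
    (hα : IsAlgebraic ℚ α) (hirr : ∀ r : ℚ, α ≠ (r : ℂ)) {y : ℂ} (hy : HyperLatApprox 1 (cexp α) y)
    {v : ℂ} (hv : v ∈ Submodule.span ℤ (Set.range (latTriple 1 (cexp α) y)))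
    (halg : IsAlgebraic ℚ v) : ∃ a : ℤ, v = a := by
  obtain ⟨c, hc⟩ := (Submodule.mem_span_range_iff_exists_fun ℤ).mp hv
  rw [Fin.sum_univ_three] at hc
  simp only [latTriple_zero, latTriple_one, latTriple_two, zsmul_eq_mul, mul_one] at hc
  by_cases hbc : c 1 = 0 ∧ c 2 = 0
  · refine ⟨c 0, ?_⟩
    rw [← hc, hbc.1, hbc.2]; simp
  · exfalso
    have hbc' : c 1 ≠ 0 ∨ c 2 ≠ 0 := by
      by_contra hn; push Not at hn; exact hbc ⟨by tauto, by tauto⟩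
    have hθ1 : (fun i => cexp ((![(1 : ℂ), α] : Fin 2 → ℂ) i)) 1 = cexp α := by simp
    have := not_isAlgebraic_affine (algebraicIndependent_latTriple_one_cexp hLW hα hirr hy) hθ1
      (a := c 0) hbc'
    rw [hc] at this
    exact this halg

/-- `(y_E, e, e^{−√2})` is algebraically independent over ℚ (mod the LW measure). -/
theorem algebraicIndependent_zE (hLW : LWMeasure) :
    AlgebraicIndependent ℚ (fun o : Option (Fin 2) =>
      o.elim (yx ξE : ℂ) (fun i => cexp ((![(1 : ℂ), αE] : Fin 2 → ℂ) i))) :=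
  algebraicIndependent_latTriple_one_cexp hLW isAlgebraic_αE αE_ne_ratCast (cexp_αE ▸ hyperLatApprox_yE)

/-- **ℓ2-MEMBERSHIP OF `z_E` (mod the LW measure)**: the algebraic numbers in `span_ℤ(z_E)` are
exactly the integers — ONE algebraic line `ℤ · 1`; in particular `z_E` is outside the g15 cell
(`HasRealQuadAnchor` needs a SECOND algebraic line `ℤ√D`). -/
theorem eq_intCast_of_isAlgebraic_mem_span_zE (hLW : LWMeasure) {v : ℂ}
    (hv : v ∈ Submodule.span ℤ (Set.range zE)) (halg : IsAlgebraic ℚ v) : ∃ a : ℤ, v = a := by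
  rw [zE_eq] at hv
  exact eq_intCast_of_isAlgebraic_mem_span_latTriple hLW isAlgebraic_αE αE_ne_ratCast
    (cexp_αE ▸ hyperLatApprox_yE) hv halg

end LatCell

end HyperCell

end Summit.Schanuel.Schanuel.Theorems.RootDecomp1KHyper
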